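import Summits.Ventures.PercRepro.Night2FatDDNine
import Summits.Ventures.PercRepro.Night2FatDDNineA1
import Summits.Ventures.PercRepro.Night2FatDDNineA2
import Summits.Ventures.PercRepro.Night2FatDDNineA3
import Summits.Ventures.PercRepro.Night2FatDDCells

/-!
# night-2: the doubly degenerate regime at `N = 9` — every lossy basis pair

* **`dd_arith_N9`**: the scaled integer inequality of `Night2FatDDNum9` in the `(n, cls)`-form of
  `basis_pair_fair_fat_dd_of_numeric_nine` follows from the cell facts alone — the side patterns (the spine point of
  each side line: none / a basis point / a point of `W`) are dispatched to the nine lemmas `dd_arith_N9_p??`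
  (`Night2FatDDNineA1/A2/A3`), which dispatch the class flags to the `decide` lemmas `dd_num_N9_c??_p??`;
* **`basis_pair_fair_fat_dd_nine`**: every lossy basis pair of the doubly degenerate regime with `N = 9` has the
  fair share (`dd_cell_facts` + `n₂, n₃ ≤ 2` + `dd_arith_N9` + `basis_pair_fair_fat_dd_of_numeric_nine`).
Paper `proofs/NIGHT-2-g35.md` §7 (generated by `gen_ddn.py 9`).
-/

namespace PercRepro.Shadow

open PercRepro.ThmH PercRepro.PerFlat

variable {α : Type*} [DecidableEq α] {M : Matroid α} [M.Finite] {G : Finset α}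

/-- **The numeric inequality at `N = 9` from the cell facts** (`c₁, c₂, c₃` the class flags of the spine and the two
side lines — the spine is always class —, `nL, nA, nM` / `tL, tA, tM` the basis / `W`-points of the three cells,
`n₂, s₂` / `n₃, s₃` the basis / `W`-points of the two side lines; `n₂, n₃ ≤ 2` from the independence of the basis
points on a rank-`2` cell). -/
theorem dd_arith_N9 (c₁ c₂ c₃ : Prop) [Decidable c₁] [Decidable c₂] [Decidable c₃]
    (nL nA nM tL tA tM n₂ s₂ n₃ s₃ : ℕ) (hc₁ : c₁)
    (h1 : nL + nA + nM = 4) (h2 : tL + tA + tM = 8) (h3 : nL + nA ≤ 3) (h4 : nL + nM ≤ 3)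
    (h5 : 3 ≤ tL + nL) (h6 : 3 ≤ nA + tA) (h7 : 3 ≤ nM + tM)
    (h8 : nA ≤ n₂ ∧ tA ≤ s₂ ∧ (n₂ - nA) + (s₂ - tA) ≤ 1)
    (h9 : nM ≤ n₃ ∧ tM ≤ s₃ ∧ (n₃ - nM) + (s₃ - tM) ≤ 1) (h10 : n₂ ≤ 2) (h11 : n₃ ≤ 2) :
    let bad : ℕ → ℕ := fun k =>
        (if c₁ then (if 1 ≤ nL then (tL).choose k else 0) + (if 2 ≤ nL then (8 - tL) * (tL).choose (k - 1) else 0) else (if 2 ≤ nL then (tL).choose k else 0)) +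
        (if c₂ then (if 1 ≤ n₂ then (s₂).choose k else 0) + (if 2 ≤ n₂ then (8 - s₂) * (s₂).choose (k - 1) else 0) else (if 2 ≤ n₂ then (s₂).choose k else 0)) +
        (if c₃ then (if 1 ≤ n₃ then (s₃).choose k else 0) + (if 2 ≤ n₃ then (8 - s₃) * (s₃).choose (k - 1) else 0) else (if 2 ≤ n₃ then (s₃).choose k else 0));
    1531530 ≤ 762300 +
        152460 * (8 - (if 2 ≤ n₂ ∧ ¬ c₂ then s₂ else 0) - (if 2 ≤ n₃ ∧ ¬ c₃ then s₃ else 0)) +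
        50820 * (Nat.choose 8 2 - bad 2) +
        21780 * (Nat.choose 8 3 - bad 3) +
        10890 * (Nat.choose 8 4 - bad 4) +
        9900 * (Nat.choose 8 5 - bad 5) +
        5940 * (Nat.choose 8 6 - bad 6) +
        3780 * (Nat.choose 8 7 - bad 7) +
        2520 * (Nat.choose 8 8 - bad 8) := by
  intro bad
  obtain ⟨h8a, h8b, h8c⟩ := h8
  obtain ⟨h9a, h9b, h9c⟩ := h9
  obtain rfl : nM = 4 - nL - nA := by omega
  obtain rfl : tM = 8 - tL - tA := by omega
  rcases (show (nA = n₂ ∧ tA = s₂) ∨ (n₂ = nA + 1 ∧ tA = s₂) ∨ (nA = n₂ ∧ s₂ = tA + 1) by omega) with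
    ⟨rfl, rfl⟩ | ⟨rfl, rfl⟩ | ⟨rfl, rfl⟩
  · -- `p₂ = 0`
    rcases (show (n₃ = 4 - nL - nA ∧ s₃ = 8 - tL - tA) ∨ (n₃ = 4 - nL - nA + 1 ∧ s₃ = 8 - tL - tA) ∨
        (n₃ = 4 - nL - nA ∧ s₃ = 8 - tL - tA + 1) by omega) with ⟨rfl, rfl⟩ | ⟨rfl, rfl⟩ | ⟨rfl, rfl⟩
    · exact dd_arith_N9_p00 c₁ c₂ c₃ nL nA tL tA hc₁ h2 h3 h4 h5 h6 h7 h10 h11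
    · exact dd_arith_N9_p01 c₁ c₂ c₃ nL nA tL tA hc₁ h2 h3 h4 h5 h6 h7 h10 h11
    · exact dd_arith_N9_p02 c₁ c₂ c₃ nL nA tL tA hc₁ h2 h3 h4 h5 h6 h7 h10 h11
  · -- `p₂ = 1`
    rcases (show (n₃ = 4 - nL - nA ∧ s₃ = 8 - tL - tA) ∨ (n₃ = 4 - nL - nA + 1 ∧ s₃ = 8 - tL - tA) ∨
        (n₃ = 4 - nL - nA ∧ s₃ = 8 - tL - tA + 1) by omega) with ⟨rfl, rfl⟩ | ⟨rfl, rfl⟩ | ⟨rfl, rfl⟩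
    · exact dd_arith_N9_p10 c₁ c₂ c₃ nL nA tL tA hc₁ h2 h3 h4 h5 h6 h7 h10 h11
    · exact dd_arith_N9_p11 c₁ c₂ c₃ nL nA tL tA hc₁ h2 h3 h4 h5 h6 h7 h10 h11
    · exact dd_arith_N9_p12 c₁ c₂ c₃ nL nA tL tA hc₁ h2 h3 h4 h5 h6 h7 h10 h11
  · -- `p₂ = 2`
    rcases (show (n₃ = 4 - nL - nA ∧ s₃ = 8 - tL - tA) ∨ (n₃ = 4 - nL - nA + 1 ∧ s₃ = 8 - tL - tA) ∨
        (n₃ = 4 - nL - nA ∧ s₃ = 8 - tL - tA + 1) by omega) with ⟨rfl, rfl⟩ | ⟨rfl, rfl⟩ | ⟨rfl, rfl⟩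
    · exact dd_arith_N9_p20 c₁ c₂ c₃ nL nA tL tA hc₁ h2 h3 h4 h5 h6 h7 h10 h11
    · exact dd_arith_N9_p21 c₁ c₂ c₃ nL nA tL tA hc₁ h2 h3 h4 h5 h6 h7 h10 h11
    · exact dd_arith_N9_p22 c₁ c₂ c₃ nL nA tL tA hc₁ h2 h3 h4 h5 h6 h7 h10 h11

/-- **The fair share of every lossy basis pair of the doubly degenerate regime at `N = 9`.** -/
theorem basis_pair_fair_fat_dd_nine (hG : G ∈ flatsQ M (5 + 1)) (hd : (gr M \ G).card = 2)
    (hk : kColoops M G = 1) (hs : ∀ e ∈ gr M, ∀ f ∈ gr M, e ≠ f → rkN M {e, f} = 2)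
    (hl : ∀ e ∈ gr M, M.Indep {e}) (hfat : (fatClosures M 5 G 2).card ≤ 1) {B₀ : Finset α}
    (hB₀ : B₀ ∈ thinMembers M 5 G) {w₀ x : α} (hD : G \ clF M B₀ = {w₀, x}) (hne : w₀ ≠ x) {R₁ : Finset α}
    (hR₁V : R₁ ⊆ (G \ coloops M G) \ {w₀, x}) (hR₁2 : rkN M R₁ = 2) (hR₁3 : 3 ≤ R₁.card)
    (hcop : rkN M (insert w₀ (insert x R₁)) ≤ 3) {c₂ c₃ : α}
    (hc₂V : c₂ ∈ (G \ coloops M G) \ {w₀, x}) (hc₃V : c₃ ∈ (G \ coloops M G) \ {w₀, x})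
    (hc₂ : c₂ ∉ clF M R₁) (hc₃ : c₃ ∉ clF M (insert c₂ R₁))
    (hcover : ∀ e ∈ (G \ coloops M G) \ {w₀, x}, e ∈ clF M (insert c₂ R₁) ∨ e ∈ clF M (insert c₃ R₁))
    (hdeg₂ : rkN M (((G \ coloops M G) \ {w₀, x}).filter (fun e => e ∈ clF M (insert c₂ R₁) ∧ e ∉ clF M R₁)) ≤ 2)
    (hdeg₃ : rkN M (((G \ coloops M G) \ {w₀, x}).filter (fun e => e ∈ clF M (insert c₃ R₁) ∧ e ∉ clF M R₁)) ≤ 2)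
    {B : Finset α} (hB : B ∈ thinMembers M 5 G) (hnP : ¬ bigP M G B) {z : α} (hz : z ∈ G \ clF M B)
    (hl0 : loss M 5 G B z ≠ 0) (hw₀ : w₀ ∈ insert z B) (hx : x ∉ insert z B) (hN : (G \ insert z B).card = 9) :
    loss M 5 G B z ≤ rhoL M 5 G B z * lossIncomeH M 5 G (bigP M G) (dshGT2 M 5 G) B z := by
  have hf := dd_cell_facts hG hd hk hs hfat hB₀ hD hne hR₁V hR₁2 hR₁3 hcop hc₂V hc₃V hc₂ hc₃ hcover hdeg₂ hdeg₃
    hB hnP hz hw₀ hx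
  dsimp only at hf
  obtain ⟨h1, h2, h3, h4, h5, h6, h7, h8, h9⟩ := hf
  have hxGQ : x ∈ G \ insert z B := by
    have : x ∈ G \ clF M B₀ := by rw [hD]; exact Finset.mem_insert_of_mem (Finset.mem_singleton_self _)
    exact Finset.mem_sdiff.2 ⟨(Finset.mem_sdiff.1 this).1, hx⟩
  have hWm : ((G \ insert z B).erase x).card = 8 := by
    rw [Finset.card_erase_of_mem hxGQ, hN]
  rw [hWm] at h2
  have hPind : M.Indep ((((insert z B \ coloops M G).erase w₀) : Finset α) : Set α) := basis_points_indep hG hd hk hB hnP hz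
  have h10 : (((insert z B \ coloops M G).erase w₀).filter (fun e => e ∈ clF M (((G \ coloops M G) \ {w₀, x}).filter (fun e => e ∈ clF M (insert c₂ R₁) ∧ e ∉ clF M R₁)))).card ≤ 2 := (card_filter_clF_le_rkN_of_indep hPind).trans hdeg₂
  have h11 : (((insert z B \ coloops M G).erase w₀).filter (fun e => e ∈ clF M (((G \ coloops M G) \ {w₀, x}).filter (fun e => e ∈ clF M (insert c₃ R₁) ∧ e ∉ clF M R₁)))).card ≤ 2 := (card_filter_clF_le_rkN_of_indep hPind).trans hdeg₃
  have hnum := dd_arith_N9 (rkN M (insert w₀ (insert x R₁)) ≤ 3) (rkN M (insert w₀ (insert x (((G \ coloops M G) \ {w₀, x}).filter (fun e => e ∈ clF M (insert c₂ R₁) ∧ e ∉ clF M R₁)))) ≤ 3) (rkN M (insert w₀ (insert x (((G \ coloops M G) \ {w₀, x}).filter (fun e => e ∈ clF M (insert c₃ R₁) ∧ e ∉ clF M R₁)))) ≤ 3)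
    (((insert z B \ coloops M G).erase w₀).filter (fun e => e ∈ clF M R₁)).card (((insert z B \ coloops M G).erase w₀).filter (fun e => e ∈ (((G \ coloops M G) \ {w₀, x}).filter (fun e => e ∈ clF M (insert c₂ R₁) ∧ e ∉ clF M R₁)))).card (((insert z B \ coloops M G).erase w₀).filter (fun e => e ∈ (((G \ coloops M G) \ {w₀, x}).filter (fun e => e ∈ clF M (insert c₃ R₁) ∧ e ∉ clF M R₁)))).card (((G \ insert z B).erase x).filter (fun e => e ∈ clF M R₁)).card (((G \ insert z B).erase x).filter (fun e => e ∈ (((G \ coloops M G) \ {w₀, x}).filter (fun e => e ∈ clF M (insert c₂ R₁) ∧ e ∉ clF M R₁)))).card (((G \ insert z B).erase x).filter (fun e => e ∈ (((G \ coloops M G) \ {w₀, x}).filter (fun e => e ∈ clF M (insert c₃ R₁) ∧ e ∉ clF M R₁)))).card (((insert z B \ coloops M G).erase w₀).filter (fun e => e ∈ clF M (((G \ coloops M G) \ {w₀, x}).filter (fun e => e ∈ clF M (insert c₂ R₁) ∧ e ∉ clF M R₁)))).card (((G \ insert z B).erase x).filter (fun e => e ∈ clF M (((G \ coloops M G) \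 {w₀, x}).filter (fun e => e ∈ clF M (insert c₂ R₁) ∧ e ∉ clF M R₁)))).card (((insert z B \ coloops M G).erase w₀).filter (fun e => e ∈ clF M (((G \ coloops M G) \ {w₀, x}).filter (fun e => e ∈ clF M (insert c₃ R₁) ∧ e ∉ clF M R₁)))).card (((G \ insert z B).erase x).filter (fun e => e ∈ clF M (((G \ coloops M G) \ {w₀, x}).filter (fun e => e ∈ clF M (insert c₃ R₁) ∧ e ∉ clF M R₁)))).card
    hcop h1 h2 h3 h4 h5 h6 h7 h8 h9 h10 h11
  exact basis_pair_fair_fat_dd_of_numeric_nine hG hd hk hs hl hfat hB₀ hD hne hR₁V hR₁2 hR₁3 hcop hc₂V hc₃V hc₂ hc₃ hcover hdeg₂ hdeg₃ hB hnP hz hl0 hw₀ hx hN hnum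

end PercRepro.Shadow
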